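import Mathlib
import Summits.NavierStokesRegularity.NavierStokesRegularity.Theses.DirectionDissipationQuantum
import HarnessLib

/-!
# `DirectionDissipationQuantum.Assembly` — the route's assembly (item
  stmt-NavierStokesRegularity-1919; pure logic)

**Statement.** `GeometricEpsilonRegularity → DirectionDissipationNonConcentration →
BoundedNearTopExtends → UnitViscosityReduction → NoBlowupToClay`.

PROOF. The route file `Theses/DirectionDissipationQuantum.lean` carries the planner-authored,
kernel-checked deciding theorem `Theses.DirectionDissipationQuantum.closes`, whose hypotheses are
exactly the route's items and whose conclusion is the registered leaf; the assembly item is that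
implication written as ONE proposition, so it is closed by applying `closes` to the hypotheses.

HONEST FRAMING: glue between the route's own statements (about HYPOTHETICAL objects); nothing
here bears on the regularity problem itself.
-/

noncomputable section

set_option linter.dupNamespace false

namespace Summit.NavierStokesRegularity.NavierStokesRegularity.Theorems

open Summit.NavierStokesRegularity.NavierStokesRegularity.Theses.DirectionDissipationQuantum in
/-- **Item stmt-NavierStokesRegularity-1919** (`DirectionDissipationQuantum.Assembly`): the route's
chain of items implies its registered leaf, by the route file's deciding theorem `closes`. [this
file] -/
theorem directionDissipationQuantum_assembly_proof :
    Summit.NavierStokesRegularity.NavierStokesRegularity.Theses.DirectionDissipationQuantum.Assembly := by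
  unfold Summit.NavierStokesRegularity.NavierStokesRegularity.Theses.DirectionDissipationQuantum.Assembly
  intro hA hN hExt hUnit hClay
  exact closes hA hN hExt hUnit hClay

end Summit.NavierStokesRegularity.NavierStokesRegularity.Theorems

end
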